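import Summits.QuantumFields.YangMills.Theorems.UnitScaleTiltProp7KernelRow349Pin
import Summits.QuantumFields.YangMills.Theorems.UnitScaleTiltProp7PTermLocalGaugeKnit
import HarnessLib

/-!
# Route `UnitScaleTilt`, crux K1 «MinimiserStabilityRegPr» (stmt-QuantumFields-19200), EX row `h349` after S45 — (L3′b) storey, **THE IDX KNIT, STEP 1: THE FAMILIES OF RECORD
# AT ONE MEMBER** — namer w2 g12's ✓p764315 `Prop7KernelRow349Pin.kernelRow349_pin` with its LOD data `Q″∕hseq∕ι∕hι∕T∕hT∕G∕hAG∕hGA` DISCHARGED: `hseq` from the door's ∀-form `htop`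
# (✓`Prop7PTermLocalGaugeKnit.hseq_of_htop`), the coarse reading `ι` by `rfl`, the adjoint `T := (ι ∘ Q″)†`, the massive inverse `G` by ✓`Prop7MassivePropagatorCoercive.exists_massive_inverse`
# (the pattern of ✓`Prop7DivergenceAbsorptionOfRegPr.normSq_DstarL2_le_normSq_projR_add_of_regPr'`; the pinned weight's `Fact (0 < c₀(L³)^{K−n})` is an instance binder as in the pin) — so that the (3.49) kernel row at one member and one `Q″` of record is
# CONDITIONAL ONLY on a UNIFORM gradient-column letter `hDcolU` (the (G1-3b) storey's output quantified over the families: (ii-c)∕(ii-d), px19 g13) and the numerics `am κ Cg`.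

Cell `ym3-torus` (HUMAN RULING D-0037; rung R3 = SU(2) YM₃ on T³ — NOT d = 4, NOT infinite volume, NOT a mass gap, NOT Clay).  Width seat `ym3-torus-px10` (gen 12); division of
2026-08-30 06:44:47Z∕06:45:26Z with namer w2 g12 («(b) px10 g12 = THE IDX KNIT»); my LOCATE-K349-IDX-KNIT (19200 evidence #53) §1.  THEOREMS ONLY (0 `def`, 0 `sorry`, default
heartbeats); `--supports stmt-QuantumFields-19200 --as helper`; count-neutral.

WHAT IS PROVED (ns `Summit.QuantumFields.YangMills.Theorems.Prop7KernelRow349MemberKnit`).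
* ★★★ `kernelRow349_member_of_gradColU` — for a printed-regular member (`RegPr F n K ε₀ U₀`, `10⁷L³ε₀ ≤ 1`, `n < K`), a top nested mean `Q″` OF RECORD given by the door's ∀-form clause
  `htop`, a massive weight `am > 0`, a rate `κ > 0`, a constant `Cg ≥ 0`, and the UNIFORM gradient-column letter
  `hDcolU : ∀ ι hι T hT G hAG (the LOD data at the pin `c₁ = c₀(L³)^{K−n}`), ∀ y Y b, ‖(D_{U₀} G T ι (δ_y ⊗ Y))(b)‖ ≤ Cg·e^{−κ·tdist(B b.src, y)}·‖Y‖`: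
  `‖(toL2 F K c₀).symm (D_{U₀}(D*_{U₀}(toL2 (δ_b ⊗ Z)) − projR Δ_{U₀} Q″ (D*_{U₀}(toL2 (δ_b ⊗ Z))))) bd‖ ≤ (√2·(18∕m_B(am)²)·(4(2(1+2∕κ))³)²·Cg²) · ((L:ℝ)^(K−n))⁻¹ ^ 3 · e^{−μ′(am,κ)·tdist(B b.src, B bd.src)} · ‖Z‖`
  — the pin's conclusion VERBATIM, its LOD data no longer displayed.
HYP-SAT (★★OWNER RULING №42).  `htop` is the door's own antecedent (✓p763458 `hK349`); `hDcolU` is (ii-c) ✓∕⧗`Prop7CurvedMemberGradientRowOfRegPr.column_gradient_decay_of_regPr` read at the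
pin with a member-uniform constant ((ii-d)) — a real-inequality schema, inhabited with K-free `Cg`, `κ` under that file's `hroom`∕`hsmall`; conclusion non-vacuous; no `Prop` placeholder.
HONEST SCOPE.  Plumbing (three `obtain`s and one `exact`); CONDITIONAL on `hDcolU`; nothing of (ii-c)∕(ii-d), `hK349_exists`, the small-member cover road ((c2″), px12 g16), `h349`, the
ten EX rows, `hThm2S`, EX `stub_existenceMinimalOrbit` or the crux is proved here; the Yang–Mills mass gap is NOT proved.

References: T. Bałaban, CMP **99** (1985) 389–434 [Balaban1985BackgroundPropagators] ((3.16) p.393, (3.21)–(3.27) pp.394–395, Thm 3.1 (3.42) p.397, (3.49) p.399, Thm 3.11 p.416);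
CMP **98** (1985) 17–51 [Balaban1985Averaging] ((97) p.32).
-/

set_option autoImplicit false

noncomputable section

open scoped BigOperators Matrix.Norms.L2Operator InnerProductSpace ComplexConjugate Matrix

namespace Summit.QuantumFields.YangMills.Theorems.Prop7KernelRow349MemberKnit

open Literature.MathematicalPhysics.QuantumFieldTheory.Balaban1983to89
open Literature.MathematicalPhysics.QuantumFieldTheory.Balaban1983to89.T3ContinuumYM3Torus
open T4Continuum BlockAveraging
open BlockAveraging (Idx)
open B7Prop1Explicit (disp)
open B5Eq118OneStroke (iterBlockOf)
open B10Eq27TorusAxialLog (holT transl)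
open B7TransferAnalyticMean (meanCLM)
open B9Eq311L2Pairing (WL2)
open B11Eq103H1Complex (SiteL2K BondL2K projR)
open Summit.QuantumFields.YangMills.Theorems.Prop8Chart (emlIterU)
open T3SectALandauChart (eta eta_pos bgUnits)
open T3PrintedRegularMinimiser (RegPr)
open T3PrintedRegularOrbits (sites_eq)
open T3LevelShift (siteShift)
open Summit.QuantumFields.YangMills.Theorems.Prop7SectET3Transport (periodsT3 bondEquiv)
open Summit.QuantumFields.YangMills.Theorems.Prop7SectET3HilbertLetters (W₂ toL2 toL2S DL2 DstarL2 covLapSite)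
open Summit.QuantumFields.YangMills.Theorems.Prop7KernelRow349Pin (kernelRow349_pin)
open Summit.QuantumFields.YangMills.Theorems.Prop7PTermLocalGaugeKnit (hseq_of_htop)
open Summit.QuantumFields.YangMills.Theorems.Prop7MassivePropagatorCoercive (exists_massive_inverse)

variable (F : T3Family) {n K : ℕ} (h : n ≤ K) {c₀ : ℝ} [Fact (0 < c₀)]
  {ε₀ : ℝ} (hε₀ : 0 < ε₀) (hε7 : 10 ^ 7 * (F.L : ℝ) ^ 3 * ε₀ ≤ 1)
  (U₀ : GaugeField (F.P K) 0 (Matrix.specialUnitaryGroup (Fin 2) ℂ)) (hreg : RegPr F n K ε₀ U₀)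
  (Q'' : SiteL2K ℂ 3 (periodsT3 F K) c₀ W₂ →ₗ[ℂ] (Site (F.P K) (K - n) → Matrix (Fin 2) (Fin 2) ℂ))
  (htop : ∀ (lam : Site (F.P K) 0 → Matrix (Fin 2) (Fin 2) ℂ) (ns : (j : ℕ) → Site (F.P K) j → Matrix (Fin 2) (Fin 2) ℂ), ns 0 = lam →
      (∀ (j : ℕ) (y : Site (F.P K) (j + 1)), ns (j + 1) y = ns j (emb y) - meanCLM (Idx (F.P K)) (Matrix (Fin 2) (Fin 2) ℂ) fun i : Idx (F.P K) =>
        ns j (emb y) - ((holT (emlIterU j (bgUnits F K U₀)) (emb y) (stairWord i.2.1 (off i.1)) : (Matrix (Fin 2) (Fin 2) ℂ)ˣ) : Matrix (Fin 2) (Fin 2) ℂ) *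
          ns j (transl (emb y) (disp (stairWord i.2.1 (off i.1)))) * (((holT (emlIterU j (bgUnits F K U₀)) (emb y) (stairWord i.2.1 (off i.1)))⁻¹ : (Matrix (Fin 2) (Fin 2) ℂ)ˣ) : Matrix (Fin 2) (Fin 2) ℂ)) →
      ns (K - n) = Q'' (toL2S F K c₀ lam))

include hε₀ hε7 hreg htop in
-- hb insurance (cell HEARTBEAT RULE; decl-local, never file-global): measured on the farm — fails at 100k (`whnf` in the statement), passes at 160k and at the default; same class as ✓p764315's pin.
set_option maxHeartbeats 400000 in
/-- ★★★ **THE (3.49) KERNEL ROW AT ONE MEMBER AND ONE `Q″` OF RECORD, FAMILIES DISCHARGED** — namer w2 g12's ✓`kernelRow349_pin` with `hseq := hseq_of_htop`, `ι` by `rfl`, `T := (ι∘Q″)†`,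
`G ← exists_massive_inverse`; conditional only on the UNIFORM gradient-column letter `hDcolU` ((ii-c)∕(ii-d)) and the numerics `am κ Cg`.
[cite: Balaban1985BackgroundPropagators, Thm 3.1 (3.42) p.397, (3.49) p.399, (3.24)–(3.25) p.394, Thm 3.11 p.416] -/
theorem kernelRow349_member_of_gradColU (hnK : n < K) {am : ℝ} (ham : 0 < am) [hc₁ : Fact (0 < c₀ * ((F.L : ℝ) ^ 3) ^ (K - n))]
    {κ : ℝ} (hκ : 0 < κ) {Cg : ℝ} (hCg : 0 ≤ Cg)
    (hDcolU : ∀ (ι : (Site (F.P K) (K - n) → Matrix (Fin 2) (Fin 2) ℂ) →ₗ[ℂ] SiteL2K ℂ 3 (periodsT3 F n) (c₀ * ((F.L : ℝ) ^ 3) ^ (K - n)) W₂),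
      (∀ c, ι c = toL2S F n (c₀ * ((F.L : ℝ) ^ 3) ^ (K - n)) (fun z => c (siteShift (sites_eq F n K h) z))) →
      ∀ (T : SiteL2K ℂ 3 (periodsT3 F n) (c₀ * ((F.L : ℝ) ^ 3) ^ (K - n)) W₂ →ₗ[ℂ] SiteL2K ℂ 3 (periodsT3 F K) c₀ W₂),
      (∀ (l : SiteL2K ℂ 3 (periodsT3 F K) c₀ W₂) (f : SiteL2K ℂ 3 (periodsT3 F n) (c₀ * ((F.L : ℝ) ^ 3) ^ (K - n)) W₂), ⟪ι (Q'' l), f⟫_ℂ = ⟪l, T f⟫_ℂ) →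
      ∀ (G : SiteL2K ℂ 3 (periodsT3 F K) c₀ W₂ →ₗ[ℂ] SiteL2K ℂ 3 (periodsT3 F K) c₀ W₂),
      (∀ f, covLapSite F n K c₀ U₀ (G f) + (am : ℂ) • T (ι (Q'' (G f))) = f) →
      ∀ (y : Site (F.P K) (K - n)) (Y : Matrix (Fin 2) (Fin 2) ℂ) (b : PBond (F.P K) 0),
        ‖WL2.equiv ℂ _ W₂ (DL2 F n K c₀ U₀ (G (T (ι (Pi.single y Y))))) (bondEquiv F K b)‖ ≤ Cg * Real.exp (-(κ * (Site.tdist (P := F.P K) (iterBlockOf (K - n) b.src) y : ℝ))) * ‖Y‖)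
    (b : PBond (F.P K) 0) (Z : Matrix (Fin 2) (Fin 2) ℂ) (bd : PBond (F.P K) 0) :
    ‖(toL2 F K c₀).symm (DL2 F n K c₀ U₀ (DstarL2 F n K c₀ U₀ (toL2 F K c₀ (Pi.single b Z)) - projR (covLapSite F n K c₀ U₀) Q'' (DstarL2 F n K c₀ U₀ (toL2 F K c₀ (Pi.single b Z))))) bd‖
      ≤ (Real.sqrt 2 * (18 / (2 / ((1 + 25 / 8) * (600 * (27 / 4 : ℝ) ^ 6 + am))) ^ 2) * (4 * (2 * (1 + 2 / κ)) ^ 3) ^ 2 * Cg ^ 2)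
        * ((F.L : ℝ) ^ (K - n))⁻¹ ^ 3
        * Real.exp (-((min ((1 / (10 * Real.sqrt (max 2 (16 / am)) * Real.sqrt (27 + 2025 / 8 * am))) / 2) (min ((2 / ((1 + 25 / 8) * (600 * (27 / 4 : ℝ) ^ 6 + am))) / (3 * (Real.sqrt (max 2 (16 / am)) * (2 + Real.sqrt (max 2 (16 / am))) * (3 * Real.sqrt 3 + 27 + 9 * Real.sqrt am * Real.sqrt (25 / 8) + 81 * am * (25 / 8))
                * (8 * Real.sqrt (max 2 (16 / am)) + 8 * Real.sqrt (max 2 (16 / am)) ^ 2) * (10 * Real.sqrt (25 / 8)) + 9 * (max 2 (16 / am)) * Real.sqrt (25 / 8)))) (κ / 2)))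
            * (Site.tdist (iterBlockOf (K - n) b.src) (iterBlockOf (K - n) bd.src) : ℝ))) * ‖Z‖ := by
  -- the ∃-form of the top-mean clause
  have hseq := hseq_of_htop F c₀ U₀ Q'' htop
  -- the coarse reading `ι` (transport to the level-`n` lattice + `toL2S`), as a linear map
  obtain ⟨ι', hι'⟩ : ∃ ι' : (Site (F.P K) (K - n) → Matrix (Fin 2) (Fin 2) ℂ) →ₗ[ℂ] SiteL2K ℂ 3 (periodsT3 F n) (c₀ * ((F.L : ℝ) ^ 3) ^ (K - n)) W₂,
      ∀ c, ι' c = toL2S F n (c₀ * ((F.L : ℝ) ^ 3) ^ (K - n)) (fun z => c (siteShift (sites_eq F n K h) z)) :=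
    ⟨(toL2S F n (c₀ * ((F.L : ℝ) ^ 3) ^ (K - n))).toLinearMap ∘ₗ LinearMap.funLeft ℂ (Matrix (Fin 2) (Fin 2) ℂ) (siteShift (sites_eq F n K h)), fun c => rfl⟩
  -- the adjoint of `ι ∘ Q″` (finite dimension)
  obtain ⟨T', hT'⟩ : ∃ T' : SiteL2K ℂ 3 (periodsT3 F n) (c₀ * ((F.L : ℝ) ^ 3) ^ (K - n)) W₂ →ₗ[ℂ] SiteL2K ℂ 3 (periodsT3 F K) c₀ W₂,
      ∀ (l : SiteL2K ℂ 3 (periodsT3 F K) c₀ W₂) (f : SiteL2K ℂ 3 (periodsT3 F n) (c₀ * ((F.L : ℝ) ^ 3) ^ (K - n)) W₂), ⟪ι' (Q'' l), f⟫_ℂ = ⟪l, T' f⟫_ℂ :=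
    ⟨LinearMap.adjoint (ι' ∘ₗ Q''), fun l f => by rw [LinearMap.adjoint_inner_right, LinearMap.comp_apply]⟩
  -- the massive inverse `G_a`
  obtain ⟨G', hAG', hGA', -⟩ := exists_massive_inverse F h hε₀ hε7 U₀ hreg Q'' hseq ι' hι' T' hT' ham
  exact kernelRow349_pin F h hε₀ hε7 U₀ hreg Q'' hseq hnK ham ι' hι' T' hT' G' hAG' hGA' hκ hCg (hDcolU ι' hι' T' hT' G' hAG') b Z bd

end Summit.QuantumFields.YangMills.Theorems.Prop7KernelRow349MemberKnit

end
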